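import Literature.AlgebraicGeometry.AbelianSchemes.IsLambdaOfAtOfIsBaseChangeVia
import Literature.AlgebraicGeometry.AbelianSchemes.AbelianSchemeFibreHom
import Literature.AlgebraicGeometry.AbelianSchemes.AbelianSchemeOverLevelBaseChange
import Literature.AlgebraicGeometry.AbelianVarieties.AbelianVarietyWeilDivisorBundleDictionary
import HarnessLib

/-!
# `Λ(ψ^*𝒪(Θ_B)) = ψ^∨ ∘ Λ(𝒪(Θ_B)) ∘ ψ` at a geometric point, and the divisor-level Hecke polarisation clause
# `D_Q(ψ^*Θ_B) ∼ ν · D_Q(Θ′)` from `ψ^∨ λ_B ψ = ν λ′`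

Layer `Literature/AlgebraicGeometry/AbelianSchemes`, namespace `Literature.AlgebraicGeometry.AbelianSchemes.AbelianSchemeOver`.
THEOREMS ONLY (no definition, no named fact, no instance, no `sorry`).  Cell `hodgecm-mathlib` (D-0151), HECKE-LINK
brick (T3b)-ENGINE (B-plan1 (g14) 20:35Z; count-neutral PROOF-lane capital): the input `hφ` of ★ B-p15's (W′)
`weilPairingLevel_map_map_eq_of_mixedLevel` and `hW` of B-p14's (β3F) `quotient_typeFrame`, read at one geometric point
`s` of the base from the two clauses by which an isogeny `ψ : A′ → B` of abelian schemes over `S` with «dual» `ψd : B̂ → Â′`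
relates two polarisations: the POINCARÉ CLAUSE (e1) `(ψ × 1_{B̂})^*𝒫_B ≅ (1_{A′} × ψd)^*𝒫′` on `A′ ×_S B̂` (the defining
property of the dual morphism, [MumfordAV1970] §20 (3) / [MilneAV2008] I §8) and the `λ`-CLAUSE (b) `ψ ≫ λ_B ≫ ψd = λ′^ν`
([MumfordAV1970] §23 «descending a polarisation along an isogeny»; [MumfordFogartyKirwan1994] Ch. 6 §2 (6.3)).
HC_CM is proved only modulo the 7 printed citations until rung 0 closes.

Everything is «map as a variable»: the product maps `mψ = ψ × 1`, `mψd = 1 × ψd` enter through their projections, (e1) as a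
bare module isomorphism `eP`, (b) as an equation in Mathlib's `Hom.group` on `A′.X ⟶ D′.hat.X`.

* §V `AbelianVariety.weilDiv_nsmul_linEquiv` — `D_Q(n • Θ) ∼ n • D_Q(Θ)` (classes in `Ȟ¹(A, 𝒪^×)`: `D ↦ [𝒪(D)]` is additive,
  [GortzWedhorn2020] Prop. 11.21; private copies of ★ `cechClass_nsmul` / ★ `cechClass_neg_eq_inv` keep the import cone algebraic).
* §P powers of a homomorphism `λ`: `λ̄^ν(Q) = λ̄(Q^ν)` (`valueAt_pow`, `sliceAt_pow`; the power of a fibre point goes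
  through `pr_A` to `[ν]_A`, `fibrePointToLeft_pow`, adapted from ★ `Summits/…/UeP4bFlatLevelReadingsPins`
  `pow_left_comp_eq_of_isBaseChangeVia`), whence **`IsLambdaOfAt.pow_nsmul`** — `λ̄ = Λ(𝒪(Θ))` at `s` ⟹ `λ̄^ν = Λ(𝒪(ν • Θ))` at
  `s` («`Λ(L^ν) = ν Λ(L)`»: slice at `λ̄(Q^ν)` + the theorem of the square ★ `nsmul_weilDiv_linEquiv`, [MumfordAV1970] §6 Cor. 4,
  through the (D-2) dictionary ★ `weilDiv_linEquiv_iff_nonempty_translateTensorDual_iso`) and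
  `IsLambdaOfAt.weilDiv_linEquiv_nsmul_of_pow` (a witness `Θν` of `λ̄^ν` has `D_Q(Θν) ∼ ν · D_Q(Θ)`).  The WITNESS CONGRUENCE
  `IsLambdaOfAt.weilDiv_linEquiv` is B-p14's ★ `IsLambdaOfAtWitnessCongruence` (not restated here).
* §E **`IsLambdaOfAt.pullback_isogeny`** — `λ̄_B = Λ(𝒪(Θ_B))` at `s` ⟹ `ψ ≫ λ_B ≫ ψd` is `Λ(𝒪(ψ_s^*Θ_B))` at `s`
  ([MumfordAV1970] §23 / [MumfordFogartyKirwan1994] (6.3): «`Λ(ψ^*L) = ψ̂ ∘ Λ(L) ∘ ψ`»): the two-scheme engine ★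
  `IsLambdaOfAt.transport₂` along `ψ_s` (★ `fibreHom`), fed with the slice square through `A′ ×_S B̂` and (e1).
* §H **`weilDiv_pullback_fibreHom_linEquiv_nsmul`** — THE HEAD: under (e1) and (b), witnesses `Θ′` of `λ̄′` and `Θ_B` of
  `λ̄_B` at `s` satisfy `D_Q(ψ_s^*Θ_B) ∼ ν · D_Q(Θ′)` for every `Q ∈ A′_s(Ω)` — literally the `hφ` binder of ★ (W′) with
  `A := A′_s`, `ψ := ψ_s`, `Θ_A := Θ′`.  `Ω` is any field; ampleness is not used.

## References
* [MumfordAV1970] D. Mumford, *Abelian Varieties* (1970), §6 Cor. 4 (theorem of the square), §20 (property (3) of `e_n`,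
  p. 186), §23 (Thm. 2, p. 231: polarisations and isogenies).
* [MumfordFogartyKirwan1994] D. Mumford, J. Fogarty, F. Kirwan, *Geometric Invariant Theory* (3rd ed., 1994), Ch. 6 §2
  Definition 6.2–6.3 (p. 120) and (6.3) (p. 121); Ch. 7 §2 Definition 7.2 (p. 129).
* [MilneAV2008] J. S. Milne, *Abelian Varieties* (v2.00, 2008), I §8 pp. 36–37 (the dual morphism).
* [Hartshorne1977] R. Hartshorne, *Algebraic Geometry* (1977), III Ex. 4.5.
* [GortzWedhorn2020] U. Görtz, T. Wedhorn, *Algebraic Geometry I* (2nd ed., 2020), Section (11.9) and Prop. 11.21 (pp. 301–302).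
-/

noncomputable section

open CategoryTheory CategoryTheory.Limits AlgebraicGeometry MonoidalCategory

universe u

namespace Literature.AlgebraicGeometry.AbelianSchemes

open Literature.AlgebraicGeometry.Motives Literature.AlgebraicGeometry.AbelianVarieties
  Literature.AlgebraicGeometry.Modules
open scoped MonObj
open Literature.AlgebraicGeometry.Motives.RatFn

/-! ### §V `D_Q(n • Θ) ∼ n • D_Q(Θ)` on an abelian variety -/

section ClassAlgebra

variable {Y : Scheme.{u}} [IsIntegral Y] (E : CartierDivisor Y)

/-- `[𝒪(−E)] = [𝒪(E)]⁻¹` (private copy of ★ `AbelianVariety.cechClass_neg_eq_inv`, stated for any integral scheme).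
[cite: GortzWedhorn2020, Prop. 11.21 (pp. 301–302)] -/
private theorem cechClass_neg' : (-E).cechClass = (E.cechClass)⁻¹ := by
  have h0 : (E + -E).cechClass = 1 := by
    rw [(CartierDivisor.cechClass_eq_iff_linEquiv _ _).2
      (CartierDivisor.LinEquiv.add_neg (CartierDivisor.LinEquiv.refl E)), CartierDivisor.cechClass_zero]
  rw [CartierDivisor.cechClass_add] at h0
  exact eq_inv_of_mul_eq_one_right h0

/-- `[𝒪(m • E)] = [𝒪(E)]ᵐ` (private copy of ★ `CartierDivisor.cechClass_nsmul`, whose home file lies outside the algebraic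
import cone). [cite: GortzWedhorn2020, Section (11.9) and Prop. 11.21 (pp. 301–302)] -/
private theorem cechClass_nsmul' : ∀ m : ℕ, (m • E).cechClass = E.cechClass ^ m
  | 0 => by
    have h0 : (0 • E).LinEquiv (0 • E + 0 • E) :=
      CartierDivisor.SameDivisor.linEquiv fun i p x _ _ ↦ by
        change IsUnitAt x (E.f i ^ 0 / (E.f p.1 ^ 0 * E.f p.2 ^ 0))
        rw [pow_zero, pow_zero, pow_zero, mul_one, div_one]
        exact isUnitAt_one
    have h := (CartierDivisor.cechClass_eq_iff_linEquiv _ _).2 h0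
    rw [CartierDivisor.cechClass_add] at h
    rw [pow_zero]
    exact left_eq_mul.1 h
  | m + 1 => by
    have h1 : ((m + 1) • E).LinEquiv (m • E + E) :=
      CartierDivisor.SameDivisor.linEquiv fun i p x hi hp ↦ by
        change IsUnitAt x (E.f i ^ (m + 1) / (E.f p.1 ^ m * E.f p.2))
        rw [pow_succ, mul_div_mul_comm, ← div_pow]
        exact ((E.isUnitAt_div i p.1 x hi hp.1).pow m).mul (E.isUnitAt_div i p.2 x hi hp.2)
    rw [(CartierDivisor.cechClass_eq_iff_linEquiv _ _).2 h1, CartierDivisor.cechClass_add, cechClass_nsmul' m, pow_succ]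

end ClassAlgebra

/-- **`D_Q(n • Θ) ∼ n • D_Q(Θ)`** on an abelian variety (`D_Q(Θ) = t_Q^*Θ − Θ`, ★ `weilDiv`): in `Ȟ¹(A, 𝒪_A^×)` both classes are
`(t_Q^*[Θ]·[Θ]⁻¹)ⁿ` (`D ↦ [𝒪(D)]` is additive and commutes with pull-back, [GortzWedhorn2020] Prop. 11.21).
[cite: MumfordAV1970, §8 (definition of φ_L)] [cite: GortzWedhorn2020, Prop. 11.21 (pp. 301–302)] -/
theorem _root_.Literature.AlgebraicGeometry.Motives.AbelianVariety.weilDiv_nsmul_linEquiv {K : Type u} [Field K]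
    (B : AbelianVariety K) (Θ : CartierDivisor B.X.left) (Q : B.Points K) (n : ℕ) :
    (B.weilDiv (n • Θ) Q).LinEquiv (n • B.weilDiv Θ Q) := by
  rw [← CartierDivisor.cechClass_eq_iff_linEquiv]
  unfold AbelianVariety.weilDiv
  rw [CartierDivisor.cechClass_add, CartierDivisor.cechClass_pullback, cechClass_neg', cechClass_nsmul', cechClass_nsmul',
    CartierDivisor.cechClass_add, CartierDivisor.cechClass_pullback, cechClass_neg', map_pow, mul_pow, inv_pow]

namespace AbelianSchemeOver

variable {S : Scheme.{u}} (A : AbelianSchemeOver S) (D : A.DualPair) (lam : A.X ⟶ D.hat.X)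
  {Ω : Type u} [Field Ω] (s : Spec (.of Ω) ⟶ S)

/-! ### §P Powers of a homomorphism `λ`: `λ̄^ν(Q) = λ̄(Q^ν)` -/

section Pow

/-- Powers of points go through a base change of group schemes: `(R^n) ≫ G = (R ≫ G) ≫ [n]` (adapted verbatim from ★
`Summits/HodgeConjecture/HodgeConjecture/Theorems/UeP4bFlatLevelReadingsPins.pow_left_comp_eq_of_isBaseChangeVia`, which a
Literature file cannot import). [cite: MumfordFogartyKirwan1994, Ch. 7 §2 Definition 7.2 (p. 129)] -/
private theorem pow_left_comp_eq_of_isBaseChangeVia' {S' : Scheme.{u}} {A' : AbelianSchemeOver S'}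
    {g : S' ⟶ S} {G : A'.X.left ⟶ A.X.left} (w : G ≫ A.X.hom = A'.X.hom ≫ g)
    (hη : η[A'.X].left ≫ G = g ≫ η[A.X].left)
    (hμ : μ[A'.X].left ≫ G = pullback.map A'.X.hom A'.X.hom A.X.hom A.X.hom G G g w.symm w.symm ≫ μ[A.X].left)
    {T : Over S'} (R : T ⟶ A'.X) (n : ℕ) :
    ((R ^ n).left : T.left ⟶ A'.X.left) ≫ G = (R.left ≫ G) ≫ (((𝟙 A.X : A.X ⟶ A.X) ^ n).left : A.X.left ⟶ A.X.left) := by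
  have hη' : @CategoryStruct.comp Scheme _ S' A'.X.left A.X.left (η[A'.X]).left G =
      @CategoryStruct.comp Scheme _ S' S A.X.left g (η[A.X]).left := hη
  have hμ' : @CategoryStruct.comp Scheme _ (pullback A'.X.hom A'.X.hom) A'.X.left A.X.left (μ[A'.X]).left G =
      pullback.map A'.X.hom A'.X.hom A.X.hom A.X.hom G G g w.symm w.symm ≫
        ((μ[A.X]).left : pullback A.X.hom A.X.hom ⟶ A.X.left) := hμ
  induction n with
  | zero =>
      have h1 : ((R ^ 0).left : T.left ⟶ A'.X.left) = T.hom ≫ ((η[A'.X]).left : S' ⟶ A'.X.left) := by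
        rw [pow_zero, Hom.one_def]; rfl
      have h2 : (((𝟙 A.X : A.X ⟶ A.X) ^ 0).left : A.X.left ⟶ A.X.left) = A.X.hom ≫ ((η[A.X]).left : S ⟶ A.X.left) := by
        rw [pow_zero, Hom.one_def]; rfl
      rw [h1, h2, Category.assoc, hη', Category.assoc, reassoc_of% w, reassoc_of% (Over.w R)]
  | succ n ih =>
      have h1 : ((R ^ (n + 1)).left : T.left ⟶ A'.X.left) =
          pullback.lift ((R ^ n).left : T.left ⟶ A'.X.left) (R.left : T.left ⟶ A'.X.left)
              ((Over.w (R ^ n)).trans (Over.w R).symm) ≫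
            ((μ[A'.X]).left : pullback A'.X.hom A'.X.hom ⟶ A'.X.left) := by
        rw [pow_succ, Hom.mul_def]; rfl
      have h2 : (((𝟙 A.X : A.X ⟶ A.X) ^ (n + 1)).left : A.X.left ⟶ A.X.left) =
          pullback.lift (((𝟙 A.X : A.X ⟶ A.X) ^ n).left : A.X.left ⟶ A.X.left) (𝟙 A.X.left)
              ((Over.w ((𝟙 A.X : A.X ⟶ A.X) ^ n)).trans (Category.id_comp _).symm) ≫
            ((μ[A.X]).left : pullback A.X.hom A.X.hom ⟶ A.X.left) := by
        rw [pow_succ, Hom.mul_def]; rfl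
      have key : pullback.lift ((R ^ n).left : T.left ⟶ A'.X.left) (R.left : T.left ⟶ A'.X.left)
              ((Over.w (R ^ n)).trans (Over.w R).symm) ≫
            pullback.map A'.X.hom A'.X.hom A.X.hom A.X.hom G G g w.symm w.symm =
          (R.left ≫ G) ≫ pullback.lift (((𝟙 A.X : A.X ⟶ A.X) ^ n).left : A.X.left ⟶ A.X.left) (𝟙 A.X.left)
              ((Over.w ((𝟙 A.X : A.X ⟶ A.X) ^ n)).trans (Category.id_comp _).symm) := by
        apply pullback.hom_ext
        · simp only [Category.assoc, pullback.lift_fst, pullback.lift_fst_assoc, ih]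
        · simp only [Category.assoc, pullback.lift_snd, pullback.lift_snd_assoc, Category.comp_id]
      rw [h1, h2, Category.assoc, hμ', reassoc_of% key, Category.assoc]

/-- **The point of `A` under `Q^n` is the point under `Q` followed by `[n]_A = (𝟙 A)^n`** — the fibre `A_s = A ×_S Spec Ω`
is a base change of group schemes (★ `baseChange_isBaseChangeVia`). [cite: MumfordFogartyKirwan1994, Ch. 7 §2 Definition 7.2 (p. 129)] -/
theorem fibrePointToLeft_pow (Q : (A.fibre s).toAbelianVariety.Points Ω) (n : ℕ) :
    A.fibrePointToLeft s (Q ^ n) = A.fibrePointToLeft s Q ≫ ((𝟙 A.X : A.X ⟶ A.X) ^ n).left := by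
  obtain ⟨w, -, hη, hμ⟩ := A.baseChange_isBaseChangeVia s
  exact A.pow_left_comp_eq_of_isBaseChangeVia' w hη hμ Q n

variable [IsMonHom lam]

/-- **`λ̄^n(Q) = λ̄(Q^n)`** for a homomorphism `λ : A → Â` (`λ^n = [n] ≫ λ`, Mathlib `MonObj.pow_comp`).
[cite: MumfordFogartyKirwan1994, Ch. 6 §2 Definition 6.3 (p. 120)] -/
theorem valueAt_pow (Q : (A.fibre s).toAbelianVariety.Points Ω) (n : ℕ) :
    A.valueAt s D (lam ^ n) Q = A.valueAt s D lam (Q ^ n) := by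
  have h : lam ^ n = ((𝟙 A.X : A.X ⟶ A.X) ^ n) ≫ lam := by rw [MonObj.pow_comp, Category.id_comp]
  change A.fibrePointToLeft s Q ≫ (lam ^ n).left = A.fibrePointToLeft s (Q ^ n) ≫ lam.left
  rw [h, Over.comp_left, ← Category.assoc, ← A.fibrePointToLeft_pow s Q n]

/-- **The slice of `A_s` at `λ̄^n(Q)` is the slice at `λ̄(Q^n)`.** [cite: MumfordFogartyKirwan1994, Ch. 6 §2 Definition 6.2 (p. 120)] -/
theorem sliceAt_pow (Q : (A.fibre s).toAbelianVariety.Points Ω) (n : ℕ) :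
    A.sliceAt s D (lam ^ n) Q = A.sliceAt s D lam (Q ^ n) := by
  apply pullback.hom_ext
  · rw [A.sliceAt_fst, A.sliceAt_fst]
  · rw [A.sliceAt_snd, A.sliceAt_snd, A.valueAt_pow D lam s Q n]

/-- **`D_Q(Θν) ∼ ν · D_Q(Θ)` for a witness `Θ` of `λ̄` and a witness `Θν` of `λ̄^ν`** (`λ` a homomorphism):
`t_Q^*𝒪(Θν) ⊗ 𝒪(Θν)⁻¹ ≅ 𝒫|_{A_s × {λ̄^ν(Q)}} = 𝒫|_{A_s × {λ̄(Q^ν)}} ≅ t_{Q^ν}^*𝒪(Θ) ⊗ 𝒪(Θ)⁻¹`, so `D_Q(Θν) ∼ D_{Q^ν}(Θ) ∼ ν·D_Q(Θ)`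
(theorem of the square, ★ `nsmul_weilDiv_linEquiv`). [cite: MumfordFogartyKirwan1994, Ch. 6 §2 Definition 6.2–6.3 (p. 120)]
[cite: MumfordAV1970, §6 Cor. 4] -/
theorem IsLambdaOfAt.weilDiv_linEquiv_nsmul_of_pow {ν : ℕ} {Θ Θν : CartierDivisor (A.fibre s).toAbelianVariety.X.left}
    (h : A.IsLambdaOfAt s D lam Θ) (hν : A.IsLambdaOfAt s D (lam ^ ν) Θν) (Q : (A.fibre s).toAbelianVariety.Points Ω) :
    ((A.fibre s).toAbelianVariety.weilDiv Θν Q).LinEquiv (ν • (A.fibre s).toAbelianVariety.weilDiv Θ Q) := by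
  obtain ⟨iν⟩ := hν Q
  obtain ⟨i⟩ := h (Q ^ ν)
  have j : (Scheme.Modules.pullback (A.sliceAt s D (lam ^ ν) Q)).obj D.P ≅
      (Scheme.Modules.pullback (A.sliceAt s D lam (Q ^ ν))).obj D.P :=
    (Scheme.Modules.pullbackCongr (A.sliceAt_pow D lam s Q ν)).app D.P
  have step : ((A.fibre s).toAbelianVariety.weilDiv Θν Q).LinEquiv ((A.fibre s).toAbelianVariety.weilDiv Θ (Q ^ ν)) :=
    (weilDiv_linEquiv_iff_nonempty_translateTensorDual_iso (A.fibre s).toAbelianVariety Θ Θν (Q ^ ν) Q).2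
      ⟨iν.symm ≪≫ j ≪≫ i⟩
  exact step.trans ((A.fibre s).toAbelianVariety.nsmul_weilDiv_linEquiv Θ Q ν).symm

/-- **`λ̄ = Λ(𝒪(Θ))` at `s` implies `λ̄^ν = Λ(𝒪(ν • Θ))` at `s`** («`Λ(L^ν) = ν Λ(L)`», `λ` a homomorphism): the slice of `A_s`
at `λ̄^ν(Q) = λ̄(Q^ν)` is `t_{Q^ν}^*𝒪(Θ) ⊗ 𝒪(Θ)⁻¹ ≅ t_Q^*𝒪(νΘ) ⊗ 𝒪(νΘ)⁻¹`, the last step being the (D-2) dictionary ★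
`weilDiv_linEquiv_iff_nonempty_translateTensorDual_iso` on `D_{Q^ν}(Θ) ∼ ν · D_Q(Θ) ∼ D_Q(ν • Θ)` (theorem of the square ★
`nsmul_weilDiv_linEquiv` and `weilDiv_nsmul_linEquiv`). [cite: MumfordFogartyKirwan1994, Ch. 6 §2 Definition 6.2–6.3 (p. 120)]
[cite: MumfordAV1970, §6 Cor. 4] -/
theorem IsLambdaOfAt.pow_nsmul (ν : ℕ) {Θ : CartierDivisor (A.fibre s).toAbelianVariety.X.left}
    (h : A.IsLambdaOfAt s D lam Θ) : A.IsLambdaOfAt s D (lam ^ ν) (ν • Θ) := by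
  intro Q
  obtain ⟨i⟩ := h (Q ^ ν)
  have j : (Scheme.Modules.pullback (A.sliceAt s D (lam ^ ν) Q)).obj D.P ≅
      (Scheme.Modules.pullback (A.sliceAt s D lam (Q ^ ν))).obj D.P :=
    (Scheme.Modules.pullbackCongr (A.sliceAt_pow D lam s Q ν)).app D.P
  have hlin : ((A.fibre s).toAbelianVariety.weilDiv Θ (Q ^ ν)).LinEquiv ((A.fibre s).toAbelianVariety.weilDiv (ν • Θ) Q) :=
    ((A.fibre s).toAbelianVariety.nsmul_weilDiv_linEquiv Θ Q ν).symm.trans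
      ((A.fibre s).toAbelianVariety.weilDiv_nsmul_linEquiv Θ Q ν).symm
  obtain ⟨k⟩ := (weilDiv_linEquiv_iff_nonempty_translateTensorDual_iso (A.fibre s).toAbelianVariety (ν • Θ) Θ Q
    (Q ^ ν)).1 hlin
  exact ⟨j ≪≫ i ≪≫ k⟩

end Pow

/-! ### §E `Λ(ψ^*𝒪(Θ_B)) = ψd ∘ Λ(𝒪(Θ_B)) ∘ ψ` at a geometric point -/

section Isogeny

variable (A' B : AbelianSchemeOver S) (ψ : A'.X ⟶ B.X) [IsMonHom ψ] (D' : A'.DualPair) (DB : B.DualPair)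
  (lamB : B.X ⟶ DB.hat.X) (ψd : DB.hat.X ⟶ D'.hat.X)
  (mψ : A'.prodLeft DB.hat ⟶ B.prodLeft DB.hat)
  (hmψ₁ : mψ ≫ pullback.fst B.X.hom DB.hat.X.hom = pullback.fst A'.X.hom DB.hat.X.hom ≫ ψ.left)
  (hmψ₂ : mψ ≫ pullback.snd B.X.hom DB.hat.X.hom = pullback.snd A'.X.hom DB.hat.X.hom)
  (mψd : A'.prodLeft DB.hat ⟶ A'.prodLeft D'.hat)
  (hmψd₁ : mψd ≫ pullback.fst A'.X.hom D'.hat.X.hom = pullback.fst A'.X.hom DB.hat.X.hom)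
  (hmψd₂ : mψd ≫ pullback.snd A'.X.hom D'.hat.X.hom = pullback.snd A'.X.hom DB.hat.X.hom ≫ ψd.left)
  (eP : (Scheme.Modules.pullback mψ).obj DB.P ≅ (Scheme.Modules.pullback mψd).obj D'.P)

/-- `λ̄_B(ψ_s Q)` lies over `s`: the structure equation of the intermediate slice `a ↦ (a, λ̄_B(ψ_s Q))`, `A′_s → A′ ×_S B̂`.
[cite: MumfordFogartyKirwan1994, Ch. 6 §2 Definition 6.2 (p. 120)] -/
private theorem midSlice_w (Q : (A'.fibre s).toAbelianVariety.Points Ω) :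
    pullback.fst A'.X.hom s ≫ A'.X.hom =
      (pullback.snd A'.X.hom s ≫ B.valueAt s DB lamB (AlgPoints.map (fibreHom ψ s).hom.hom.hom Q)) ≫ DB.hat.X.hom := by
  rw [pullback.condition, Category.assoc, B.valueAt_comp_hom]

include hmψd₁ hmψd₂ in
/-- **Slice square 1**: the slice of `A′_s` at `(ψ ≫ λ_B ≫ ψd)‾(Q)` in `A′ ×_S Â′` is the intermediate slice at `λ̄_B(ψ_s Q)`
in `A′ ×_S B̂` followed by `1 × ψd` (`λ̄_B(ψ_s Q) = Q ≫ ψ ≫ λ_B` by ★ `fibrePointToLeft_map_fibreHom`).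
[cite: MumfordFogartyKirwan1994, Ch. 6 §2 Definition 6.2–6.3 (p. 120)] -/
theorem midSlice_comp_oneProd_eq_sliceAt (Q : (A'.fibre s).toAbelianVariety.Points Ω) :
    pullback.lift (pullback.fst A'.X.hom s)
        (pullback.snd A'.X.hom s ≫ B.valueAt s DB lamB (AlgPoints.map (fibreHom ψ s).hom.hom.hom Q))
        (A'.midSlice_w s B ψ DB lamB Q) ≫ mψd =
      A'.sliceAt s D' (ψ ≫ lamB ≫ ψd) Q := by
  apply pullback.hom_ext
  · rw [Category.assoc, hmψd₁, pullback.lift_fst, A'.sliceAt_fst]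
  · rw [Category.assoc, hmψd₂, ← Category.assoc, pullback.lift_snd, A'.sliceAt_snd, Category.assoc]
    congr 1
    -- `λ̄_B(ψ_s Q) ≫ ψd = (ψ ≫ λ_B ≫ ψd)‾(Q)`
    change (B.fibrePointToLeft s (AlgPoints.map (fibreHom ψ s).hom.hom.hom Q) ≫ lamB.left) ≫ ψd.left =
      A'.fibrePointToLeft s Q ≫ (ψ ≫ lamB ≫ ψd).left
    rw [fibrePointToLeft_map_fibreHom ψ s Q, Over.comp_left, Over.comp_left, Category.assoc, Category.assoc]

include hmψ₁ hmψ₂ in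
/-- **Slice square 2**: the intermediate slice followed by `ψ × 1` is `ψ_s` followed by the slice of `B_s` at `λ̄_B(ψ_s Q)`
(`ψ_s ≫ pr_B = pr_{A′} ≫ ψ`, ★ `fibreHom_toSchemeHom_fst/_snd`). [cite: MumfordFogartyKirwan1994, Ch. 6 §2 Definition 6.2 (p. 120)] -/
theorem midSlice_comp_prodOne_eq_comp_sliceAt (Q : (A'.fibre s).toAbelianVariety.Points Ω) :
    pullback.lift (pullback.fst A'.X.hom s)
        (pullback.snd A'.X.hom s ≫ B.valueAt s DB lamB (AlgPoints.map (fibreHom ψ s).hom.hom.hom Q))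
        (A'.midSlice_w s B ψ DB lamB Q) ≫ mψ =
      AbelianVariety.Hom.toSchemeHom (fibreHom ψ s) ≫ B.sliceAt s DB lamB (AlgPoints.map (fibreHom ψ s).hom.hom.hom Q) := by
  apply pullback.hom_ext
  · rw [Category.assoc, hmψ₁, ← Category.assoc, pullback.lift_fst]
    exact (fibreHom_toSchemeHom_fst ψ s).symm.trans
      ((whisker_eq _ (B.sliceAt_fst s DB lamB _)).symm.trans (Category.assoc _ _ _).symm)
  · rw [Category.assoc, hmψ₂, pullback.lift_snd]
    exact (eq_whisker (fibreHom_toSchemeHom_snd ψ s) _).symm.trans ((Category.assoc _ _ _).trans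
      ((whisker_eq _ (B.sliceAt_snd s DB lamB _)).symm.trans (Category.assoc _ _ _).symm))

include hmψ₁ hmψ₂ hmψd₁ hmψd₂ eP in
/-- **(e1), slice by slice**: `𝒫′|_{A′_s × {(ψ ≫ λ_B ≫ ψd)‾(Q)}} ≅ ψ_s^*(𝒫_B|_{B_s × {λ̄_B(ψ_s Q)}})` — pull `(ψ × 1)^*𝒫_B ≅
(1 × ψd)^*𝒫′` back along the intermediate slice and re-bracket with the two slice squares (Mathlib
`Scheme.Modules.pullbackComp`/`pullbackCongr`). [cite: MumfordAV1970, §20 (property (3) of e_n, p. 186)]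
[cite: MumfordFogartyKirwan1994, Ch. 6 §2 Definition 6.2–6.3 (p. 120)] -/
theorem nonempty_pullback_sliceAt_comp_iso (Q : (A'.fibre s).toAbelianVariety.Points Ω) :
    Nonempty ((Scheme.Modules.pullback (A'.sliceAt s D' (ψ ≫ lamB ≫ ψd) Q)).obj D'.P ≅
      (Scheme.Modules.pullback (AbelianVariety.Hom.toSchemeHom (fibreHom ψ s))).obj
        ((Scheme.Modules.pullback (B.sliceAt s DB lamB (AlgPoints.map (fibreHom ψ s).hom.hom.hom Q))).obj DB.P)) := by
  let sl : pullback A'.X.hom s ⟶ A'.prodLeft DB.hat :=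
    pullback.lift (pullback.fst A'.X.hom s)
      (pullback.snd A'.X.hom s ≫ B.valueAt s DB lamB (AlgPoints.map (fibreHom ψ s).hom.hom.hom Q))
      (A'.midSlice_w s B ψ DB lamB Q)
  have h1 : A'.sliceAt s D' (ψ ≫ lamB ≫ ψd) Q = sl ≫ mψd :=
    (A'.midSlice_comp_oneProd_eq_sliceAt s B ψ D' DB lamB ψd mψd hmψd₁ hmψd₂ Q).symm
  have h2 : sl ≫ mψ = AbelianVariety.Hom.toSchemeHom (fibreHom ψ s) ≫
      B.sliceAt s DB lamB (AlgPoints.map (fibreHom ψ s).hom.hom.hom Q) :=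
    A'.midSlice_comp_prodOne_eq_comp_sliceAt s B ψ DB lamB mψ hmψ₁ hmψ₂ Q
  have i1 : (Scheme.Modules.pullback (A'.sliceAt s D' (ψ ≫ lamB ≫ ψd) Q)).obj D'.P ≅
      (Scheme.Modules.pullback (sl ≫ mψd)).obj D'.P := (Scheme.Modules.pullbackCongr h1).app D'.P
  have i2 : (Scheme.Modules.pullback (sl ≫ mψd)).obj D'.P ≅
      (Scheme.Modules.pullback sl).obj ((Scheme.Modules.pullback mψd).obj D'.P) :=
    ((Scheme.Modules.pullbackComp sl mψd).app D'.P).symm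
  have i3 : (Scheme.Modules.pullback sl).obj ((Scheme.Modules.pullback mψd).obj D'.P) ≅
      (Scheme.Modules.pullback sl).obj ((Scheme.Modules.pullback mψ).obj DB.P) := (Scheme.Modules.pullback sl).mapIso eP.symm
  have i4 : (Scheme.Modules.pullback sl).obj ((Scheme.Modules.pullback mψ).obj DB.P) ≅
      (Scheme.Modules.pullback (sl ≫ mψ)).obj DB.P := (Scheme.Modules.pullbackComp sl mψ).app DB.P
  have i5 : (Scheme.Modules.pullback (sl ≫ mψ)).obj DB.P ≅
      (Scheme.Modules.pullback (AbelianVariety.Hom.toSchemeHom (fibreHom ψ s) ≫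
        B.sliceAt s DB lamB (AlgPoints.map (fibreHom ψ s).hom.hom.hom Q))).obj DB.P :=
    (Scheme.Modules.pullbackCongr h2).app DB.P
  have i6 : (Scheme.Modules.pullback (AbelianVariety.Hom.toSchemeHom (fibreHom ψ s) ≫
        B.sliceAt s DB lamB (AlgPoints.map (fibreHom ψ s).hom.hom.hom Q))).obj DB.P ≅
      (Scheme.Modules.pullback (AbelianVariety.Hom.toSchemeHom (fibreHom ψ s))).obj
        ((Scheme.Modules.pullback (B.sliceAt s DB lamB (AlgPoints.map (fibreHom ψ s).hom.hom.hom Q))).obj DB.P) :=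
    ((Scheme.Modules.pullbackComp (AbelianVariety.Hom.toSchemeHom (fibreHom ψ s))
      (B.sliceAt s DB lamB (AlgPoints.map (fibreHom ψ s).hom.hom.hom Q))).app DB.P).symm
  exact ⟨i1 ≪≫ i2 ≪≫ i3 ≪≫ i4 ≪≫ i5 ≪≫ i6⟩

variable [IsDominant (AbelianVariety.Hom.toSchemeHom (fibreHom ψ s))]

include hmψ₁ hmψ₂ hmψd₁ hmψd₂ eP in
/-- **`Λ(ψ^*𝒪(Θ_B)) = ψd ∘ Λ(𝒪(Θ_B)) ∘ ψ` AT A GEOMETRIC POINT** ([MumfordAV1970] §23 / [MumfordFogartyKirwan1994] (6.3):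
«`Λ(ψ^*L) = ψ̂ ∘ Λ(L) ∘ ψ`»): if `Θ_B` witnesses `λ̄_B = Λ(𝒪(Θ_B))` at `s`, then `ψ_s^*Θ_B` witnesses that the `S`-morphism
`ψ ≫ λ_B ≫ ψd : A′ → Â′` is `Λ(𝒪(ψ_s^*Θ_B))` at `s` — for ANY `ψd` carrying the Poincaré clause (e1) (the dual morphism
`ψ^∨` in print).  Proof: the two-scheme engine ★ `IsLambdaOfAt.transport₂` along `ψ_s` (translations intertwine, ★
`translation_left_comp_toSchemeHom`) with the slice isomorphisms `nonempty_pullback_sliceAt_comp_iso`.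
[cite: MumfordAV1970, §23 (Thm. 2, p. 231)] [cite: MumfordFogartyKirwan1994, Ch. 6 §2 Definition 6.2–6.3 (p. 120)] -/
theorem IsLambdaOfAt.pullback_isogeny (ΘB : CartierDivisor (B.fibre s).toAbelianVariety.X.left)
    (hB : B.IsLambdaOfAt s DB lamB ΘB) :
    A'.IsLambdaOfAt s D' (ψ ≫ lamB ≫ ψd) (ΘB.pullback (AbelianVariety.Hom.toSchemeHom (fibreHom ψ s))) :=
  IsLambdaOfAt.transport₂ B DB lamB A' D' (ψ ≫ lamB ≫ ψd) (AbelianVariety.Hom.toSchemeHom (fibreHom ψ s))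
    (AlgPoints.map (fibreHom ψ s).hom.hom.hom)
    (A'.nonempty_pullback_sliceAt_comp_iso s B ψ D' DB lamB ψd mψ hmψ₁ hmψ₂ mψd hmψd₁ hmψd₂ eP)
    (fun Q => AbelianVariety.translation_left_comp_toSchemeHom (fibreHom ψ s) Q) ΘB hB

/-! ### §H THE HEAD: `D_Q(ψ_s^*Θ_B) ∼ ν · D_Q(Θ′)` -/

include hmψ₁ hmψ₂ hmψd₁ hmψd₂ eP in
/-- **THE DIVISOR-LEVEL HECKE POLARISATION CLAUSE** (brick (T3b); the `hφ` binder of ★ (W′)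
`weilPairingLevel_map_map_eq_of_mixedLevel` and B-p14's `hW`, at one geometric point `s`): let `ψ : A′ → B` be a homomorphism
of abelian schemes over `S`, `ψd : B̂ → Â′` an `S`-morphism with the Poincaré clause (e1) `(ψ × 1)^*𝒫_B ≅ (1 × ψd)^*𝒫′` and
the `λ`-clause (b) `ψ ≫ λ_B ≫ ψd = λ′^ν`, `λ′ : A′ → Â′` a homomorphism; if `Θ′` witnesses `λ̄′ = Λ(𝒪(Θ′))` and `Θ_B`
witnesses `λ̄_B = Λ(𝒪(Θ_B))` at `s`, then **`D_Q(ψ_s^*Θ_B) ∼ ν · D_Q(Θ′)` for every `Ω`-point `Q` of `A′_s`** — i.e.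
`φ_{ψ^*Θ_B} = ν φ_{Θ′}`, the divisor reading of `ψ^∨ λ_B ψ = ν λ′` ([MumfordAV1970] §23).  No ampleness, `Ω` any field.
[cite: MumfordAV1970, §23 (Thm. 2, p. 231)] [cite: MumfordFogartyKirwan1994, Ch. 6 §2 (6.3) (p. 121)] -/
theorem weilDiv_pullback_fibreHom_linEquiv_nsmul {lam' : A'.X ⟶ D'.hat.X} [IsMonHom lam'] {ν : ℕ}
    (hb : ψ ≫ lamB ≫ ψd = lam' ^ ν)
    {Θ' : CartierDivisor (A'.fibre s).toAbelianVariety.X.left} (hΘ' : A'.IsLambdaOfAt s D' lam' Θ')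
    {ΘB : CartierDivisor (B.fibre s).toAbelianVariety.X.left} (hΘB : B.IsLambdaOfAt s DB lamB ΘB)
    (Q : (A'.fibre s).toAbelianVariety.Points Ω) :
    ((A'.fibre s).toAbelianVariety.weilDiv (ΘB.pullback (AbelianVariety.Hom.toSchemeHom (fibreHom ψ s))) Q).LinEquiv
      (ν • (A'.fibre s).toAbelianVariety.weilDiv Θ' Q) := by
  have hν : A'.IsLambdaOfAt s D' (lam' ^ ν) (ΘB.pullback (AbelianVariety.Hom.toSchemeHom (fibreHom ψ s))) :=
    hb ▸ IsLambdaOfAt.pullback_isogeny s A' B ψ D' DB lamB ψd mψ hmψ₁ hmψ₂ mψd hmψd₁ hmψd₂ eP ΘB hΘB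
  exact IsLambdaOfAt.weilDiv_linEquiv_nsmul_of_pow A' D' lam' s hΘ' hν Q

include hmψ₁ hmψ₂ hmψd₁ hmψd₂ eP in
/-- The head with the `λ`-clause spelled through the multiplication map of the target, `ψ ≫ λ_B ≫ ψd = λ′ ≫ [ν]_{Â′}`
(`[ν] = (𝟙 Â′)^ν`, the shape of B-p20's file (ii) export `lam′ ≫ D′.hat.mulN ν`; Mathlib `MonObj.comp_pow`).
[cite: MumfordAV1970, §23 (Thm. 2, p. 231)] [cite: MumfordFogartyKirwan1994, Ch. 6 §2 (6.3) (p. 121)] -/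
theorem weilDiv_pullback_fibreHom_linEquiv_nsmul' {lam' : A'.X ⟶ D'.hat.X} [IsMonHom lam'] {ν : ℕ}
    (hb : ψ ≫ lamB ≫ ψd = lam' ≫ (𝟙 D'.hat.X) ^ ν)
    {Θ' : CartierDivisor (A'.fibre s).toAbelianVariety.X.left} (hΘ' : A'.IsLambdaOfAt s D' lam' Θ')
    {ΘB : CartierDivisor (B.fibre s).toAbelianVariety.X.left} (hΘB : B.IsLambdaOfAt s DB lamB ΘB)
    (Q : (A'.fibre s).toAbelianVariety.Points Ω) :
    ((A'.fibre s).toAbelianVariety.weilDiv (ΘB.pullback (AbelianVariety.Hom.toSchemeHom (fibreHom ψ s))) Q).LinEquiv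
      (ν • (A'.fibre s).toAbelianVariety.weilDiv Θ' Q) := by
  rw [MonObj.comp_pow, Category.comp_id] at hb
  exact A'.weilDiv_pullback_fibreHom_linEquiv_nsmul s B ψ D' DB lamB ψd mψ hmψ₁ hmψ₂ mψd hmψd₁ hmψd₂ eP hb hΘ' hΘB Q

end Isogeny

end AbelianSchemeOver

end Literature.AlgebraicGeometry.AbelianSchemes
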